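import Summits.Ventures.PercRepro.S1EightSixFiveThree

/-!
# PercRepro — THE SHAPE `(rank 4 on 7) ⊕ (rank 4 on 7)` OF THE `(8, 6)` CELL (p2, gen 28; SUBCLAIM-S1 §6.10
(xvii)(p); PARTIAL — towards the `(8, 6)` capstone)

Both parts coloop-free of rank `4` on `7` points with all pairs of rank `2`. With `tᵢ, q₂ᵢ, s₄ᵢ, s₅ᵢ` the rank-`2`
triples, rank-`2` four-sets, spanning `4`- and `5`-sets of part `i`: `#U ≤ 7 (35 − t₂) + (s₅₁ + t₁)(s₅₂ + t₂) +
7 (35 − t₁)`; and since every set with at least two points has rank `2`, `3` or `4` (`120` of them per part),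
`#Y ≥ 120 · 120 − f₁(2) f₂(2) − f₁(4) f₂(4) + 7 (f₁(4) + f₂(4))` with `fᵢ(2) ≤ 21 + tᵢ + q₂ᵢ`,
`fᵢ(4) ≤ 8 + s₅ᵢ + s₄ᵢ`, `s₄ᵢ + 4 tᵢ ≤ 35 + 3 q₂ᵢ`, `q₂ᵢ ≤ tᵢ`, `tᵢ + q₂ᵢ ≤ 21`: `Φ(8, 4) · #U ≤ #Y` (nlinarith;
margin `≥ 3,900` at every corner). Nothing is claimed about any cell.

* `ncard_rankSet_two_le_rank_four_seven`, `ncard_rankSet_four_le_rank_four_seven` — the upper bounds;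
* `c025_eight_four_disjointSum_four_seven_twice`.
Axioms: standard.
-/

open scoped Matroid

namespace PercRepro

namespace S1

open Set

variable {α : Type}

section RankFourOnSevenUpper

variable {N : Matroid α} [N.Finite]

/-- `f(2) ≤ 21 + t + q₂`: a rank-`2` set has `2`, `3` or `4` points (it misses at least `3`). -/
theorem ncard_rankSet_two_le_rank_four_seven (hN : N.eRank = ((4 : ℕ) : ℕ∞)) (hE : N.E.ncard = 7)
    (hcol : N.coloops = ∅) :
    (rankSet N 2).ncard ≤ 21 + (rankTwoTriples N).ncard + {Q : Set α | Q ⊆ N.E ∧ Q.ncard = 4 ∧ N.eRk Q = 2}.ncard := by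
  have hf2 : {A : Set α | A ⊆ N.E ∧ A.ncard = 2}.Finite := N.ground_finite.finite_subsets.subset (fun _ hA => hA.1)
  have hQ : {Q : Set α | Q ⊆ N.E ∧ Q.ncard = 4 ∧ N.eRk Q = 2}.Finite :=
    N.ground_finite.finite_subsets.subset (fun _ hA => hA.1)
  have hsub : rankSet N 2 ⊆ {A : Set α | A ⊆ N.E ∧ A.ncard = 2} ∪ rankTwoTriples N ∪
      {Q : Set α | Q ⊆ N.E ∧ Q.ncard = 4 ∧ N.eRk Q = 2} := by
    rintro A ⟨hAE, hA2⟩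
    have hAfin : A.Finite := N.ground_finite.subset hAE
    have hlo : 2 ≤ A.ncard := by
      have := N.eRk_le_encard A
      rw [hA2, ← hAfin.cast_ncard_eq] at this
      exact_mod_cast this
    have hmiss := sub_add_one_le_ncard_ground_sdiff_of_coloops N hN hcol hAE (k := 2) hA2 (by norm_num)
    rw [ncard_sdiff' hAE N.ground_finite, hE] at hmiss
    have hle := ncard_le_ncard hAE N.ground_finite
    rw [hE] at hle
    rcases Nat.lt_or_ge A.ncard 3 with h | h
    · left; left; exact ⟨hAE, by omega⟩
    rcases Nat.lt_or_ge A.ncard 4 with h' | h'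
    · left; right; exact ⟨hAE, by omega, hA2⟩
    · right; exact ⟨hAE, by omega, hA2⟩
  have h := ncard_le_ncard hsub ((hf2.union (rankTwoTriples_finite N)).union hQ)
  refine h.trans ((ncard_union_le _ _).trans ?_)
  refine (Nat.add_le_add_right (ncard_union_le _ _) _).trans ?_
  rw [ncard_setOf_subset_ncard_eq N.ground_finite 2, hE, show Nat.choose 7 2 = 21 by decide]

/-- `f(4) ≤ 8 + s₅ + s₄`: a spanning set is the ground set, a `6`-set, a spanning `5`-set or a spanning `4`-set. -/
theorem ncard_rankSet_four_le_rank_four_seven (hE : N.E.ncard = 7) :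
    (rankSet N 4).ncard ≤ 8 + {Q : Set α | Q ⊆ N.E ∧ Q.ncard = 5 ∧ N.eRk Q = ((4 : ℕ) : ℕ∞)}.ncard +
      {Q : Set α | Q ⊆ N.E ∧ Q.ncard = 4 ∧ N.eRk Q = ((4 : ℕ) : ℕ∞)}.ncard := by
  have hf : ∀ k : ℕ, {A : Set α | A ⊆ N.E ∧ A.ncard = k}.Finite := fun k =>
    N.ground_finite.finite_subsets.subset (fun _ hA => hA.1)
  have hS4 : {Q : Set α | Q ⊆ N.E ∧ Q.ncard = 4 ∧ N.eRk Q = ((4 : ℕ) : ℕ∞)}.Finite :=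
    (hf 4).subset (fun _ hA => ⟨hA.1, hA.2.1⟩)
  have hS5 : {Q : Set α | Q ⊆ N.E ∧ Q.ncard = 5 ∧ N.eRk Q = ((4 : ℕ) : ℕ∞)}.Finite :=
    (hf 5).subset (fun _ hA => ⟨hA.1, hA.2.1⟩)
  have hsub : rankSet N 4 ⊆ {A : Set α | A ⊆ N.E ∧ A.ncard = 7} ∪ {A : Set α | A ⊆ N.E ∧ A.ncard = 6} ∪
      {Q : Set α | Q ⊆ N.E ∧ Q.ncard = 5 ∧ N.eRk Q = ((4 : ℕ) : ℕ∞)} ∪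
      {Q : Set α | Q ⊆ N.E ∧ Q.ncard = 4 ∧ N.eRk Q = ((4 : ℕ) : ℕ∞)} := by
    rintro A ⟨hAE, hA4⟩
    have hAfin : A.Finite := N.ground_finite.subset hAE
    have hlo : 4 ≤ A.ncard := by
      have := N.eRk_le_encard A
      rw [hA4, ← hAfin.cast_ncard_eq] at this
      exact_mod_cast this
    have hle := ncard_le_ncard hAE N.ground_finite
    rw [hE] at hle
    rcases Nat.lt_or_ge A.ncard 5 with h | h
    · right; exact ⟨hAE, by omega, hA4⟩
    rcases Nat.lt_or_ge A.ncard 6 with h' | h'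
    · left; right; exact ⟨hAE, by omega, hA4⟩
    rcases Nat.lt_or_ge A.ncard 7 with h'' | h''
    · left; left; right; exact ⟨hAE, by omega⟩
    · left; left; left; exact ⟨hAE, by omega⟩
  have h := ncard_le_ncard hsub ((((hf 7).union (hf 6)).union hS5).union hS4)
  refine h.trans ((ncard_union_le _ _).trans ?_)
  refine (Nat.add_le_add_right ((ncard_union_le _ _).trans (Nat.add_le_add_right (ncard_union_le _ _) _)) _).trans ?_
  rw [ncard_setOf_subset_ncard_eq N.ground_finite 7, ncard_setOf_subset_ncard_eq N.ground_finite 6, hE,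
    show Nat.choose 7 7 = 1 by decide, show Nat.choose 7 6 = 7 by decide]

/-- `W + s₄ + q₂ ≤ 35`: the `4`-sets of rank `≠ 2` containing a rank-`2` triple, the spanning `4`-sets and the
rank-`2` four-sets are three disjoint families of `4`-sets. -/
theorem four_sets_partition_rank_four_seven (hE : N.E.ncard = 7) :
    {Q : Set α | Q ⊆ N.E ∧ Q.ncard = 4 ∧ N.eRk Q ≠ 2 ∧ ∃ T ∈ rankTwoTriples N, T ⊆ Q}.ncard +
      {Q : Set α | Q ⊆ N.E ∧ Q.ncard = 4 ∧ N.eRk Q = ((4 : ℕ) : ℕ∞)}.ncard +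
      {Q : Set α | Q ⊆ N.E ∧ Q.ncard = 4 ∧ N.eRk Q = 2}.ncard ≤ 35 := by
  have hf4 : {A : Set α | A ⊆ N.E ∧ A.ncard = 4}.Finite := N.ground_finite.finite_subsets.subset (fun _ hA => hA.1)
  have hW : {Q : Set α | Q ⊆ N.E ∧ Q.ncard = 4 ∧ N.eRk Q ≠ 2 ∧ ∃ T ∈ rankTwoTriples N, T ⊆ Q}.Finite :=
    hf4.subset (fun _ hA => ⟨hA.1, hA.2.1⟩)
  have hS : {Q : Set α | Q ⊆ N.E ∧ Q.ncard = 4 ∧ N.eRk Q = ((4 : ℕ) : ℕ∞)}.Finite :=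
    hf4.subset (fun _ hA => ⟨hA.1, hA.2.1⟩)
  have hQ : {Q : Set α | Q ⊆ N.E ∧ Q.ncard = 4 ∧ N.eRk Q = 2}.Finite := hf4.subset (fun _ hA => ⟨hA.1, hA.2.1⟩)
  have hsub : {Q : Set α | Q ⊆ N.E ∧ Q.ncard = 4 ∧ N.eRk Q ≠ 2 ∧ ∃ T ∈ rankTwoTriples N, T ⊆ Q} ∪
      {Q : Set α | Q ⊆ N.E ∧ Q.ncard = 4 ∧ N.eRk Q = ((4 : ℕ) : ℕ∞)} ∪
      {Q : Set α | Q ⊆ N.E ∧ Q.ncard = 4 ∧ N.eRk Q = 2} ⊆ {A : Set α | A ⊆ N.E ∧ A.ncard = 4} := by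
    rintro A ((⟨hAE, h4, -⟩ | ⟨hAE, h4, -⟩) | ⟨hAE, h4, -⟩) <;> exact ⟨hAE, h4⟩
  have hd1 : Disjoint {Q : Set α | Q ⊆ N.E ∧ Q.ncard = 4 ∧ N.eRk Q ≠ 2 ∧ ∃ T ∈ rankTwoTriples N, T ⊆ Q}
      {Q : Set α | Q ⊆ N.E ∧ Q.ncard = 4 ∧ N.eRk Q = ((4 : ℕ) : ℕ∞)} := by
    rw [Set.disjoint_left]
    rintro A ⟨hAE, hA4, -, T, hT, hTA⟩ ⟨-, -, h4⟩
    have hAfin : A.Finite := N.ground_finite.subset hAE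
    have h1 : (A \ T).ncard = 1 := by rw [ncard_sdiff' hTA hAfin, hA4, hT.2.1]
    obtain ⟨x, hx⟩ := ncard_eq_one.mp h1
    have hxmem : x ∈ A \ T := by rw [hx]; exact mem_singleton x
    have hAeq : A = insert x T := by
      ext w
      constructor
      · intro hw
        by_cases hwT : w ∈ T
        · exact Or.inr hwT
        · have : w ∈ A \ T := ⟨hw, hwT⟩
          rw [hx] at this
          exact Or.inl this
      · rintro (rfl | hw)
        · exact hxmem.1
        · exact hTA hw
    have hle : N.eRk A ≤ N.eRk T + 1 := by rw [hAeq]; exact N.eRk_insert_le_add_one x T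
    rw [h4, hT.2.2] at hle
    exact absurd hle (by decide)
  have hd2 : Disjoint ({Q : Set α | Q ⊆ N.E ∧ Q.ncard = 4 ∧ N.eRk Q ≠ 2 ∧ ∃ T ∈ rankTwoTriples N, T ⊆ Q} ∪
      {Q : Set α | Q ⊆ N.E ∧ Q.ncard = 4 ∧ N.eRk Q = ((4 : ℕ) : ℕ∞)})
      {Q : Set α | Q ⊆ N.E ∧ Q.ncard = 4 ∧ N.eRk Q = 2} := by
    rw [Set.disjoint_left]
    rintro A (⟨-, -, hne, -⟩ | ⟨-, -, h4⟩) ⟨-, -, h2⟩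
    · exact hne h2
    · rw [h4] at h2; exact absurd h2 (by decide)
  have h := ncard_le_ncard hsub hf4
  rwa [ncard_union_eq hd2 (hW.union hS) hQ, ncard_union_eq hd1 hW hS, ncard_setOf_subset_ncard_eq N.ground_finite 4,
    hE, show Nat.choose 7 4 = 35 by decide] at h

end RankFourOnSevenUpper

/-- The arithmetic of `(rank 4 on 7) ⊕ (rank 4 on 7)` at `(8, 4)`. -/
theorem consumer_arith_four_seven_twice {u y t1 t2 q1 q2 s41 s42 s51 s52 F12 F22 F14 F24 : ℚ}
    (hU : u + 7 * t2 + 7 * t1 ≤ 490 + (s51 + t1) * (s52 + t2))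
    (hY : 14400 + 112 + 7 * (s51 + s41 + s52 + s42) ≤ y + F12 * F22 + F14 * F24)
    (hF12 : F12 ≤ 21 + t1 + q1) (hF22 : F22 ≤ 21 + t2 + q2) (hF14 : F14 ≤ 8 + s51 + s41) (hF24 : F24 ≤ 8 + s52 + s42)
    (hs41 : s41 + 4 * t1 ≤ 35 + 3 * q1) (hs42 : s42 + 4 * t2 ≤ 35 + 3 * q2) (hq1 : q1 ≤ t1) (hq2 : q2 ≤ t2)
    (hb1 : t1 + q1 ≤ 21) (hb2 : t2 + q2 ≤ 21) (hs51 : s51 ≤ 21) (hs52 : s52 ≤ 21)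
    (ht1 : 0 ≤ t1) (ht2 : 0 ≤ t2) (hq1' : 0 ≤ q1) (hq2' : 0 ≤ q2) (hs41' : 0 ≤ s41) (hs42' : 0 ≤ s42)
    (hs51' : 0 ≤ s51) (hs52' : 0 ≤ s52) (hF22' : 0 ≤ F22) (hF24' : 0 ≤ F24) :
    76 / 15 * u ≤ y := by
  nlinarith [mul_le_mul hF12 hF22 hF22' (by linarith), mul_le_mul hF14 hF24 hF24' (by linarith),
    mul_nonneg ht1 ht2, mul_nonneg hs51' hs52', mul_nonneg ht1 hs52', mul_nonneg hs51' ht2,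
    mul_nonneg (sub_nonneg.mpr hs51) (sub_nonneg.mpr hs52), mul_nonneg (sub_nonneg.mpr hb1) (sub_nonneg.mpr hb2)]

/-- The `Y`-side of two rank-`4` parts on `7` points: the nine slices against `120 · 120 − f₁(2) f₂(2) −
f₁(4) f₂(4) + 7 (f₁(4) + f₂(4))`. -/
theorem y_products_four_seven_twice {a1 a2 a3 a4 b1 b2 b3 b4 : ℕ} (h1 : 7 ≤ a1) (h2 : 7 ≤ b1)
    (hA : 120 ≤ a2 + a3 + a4) (hB : 120 ≤ b2 + b3 + b4) :
    14400 + 7 * a4 + 7 * b4 ≤ a1 * b4 + a2 * b3 + a2 * b4 + a3 * b2 + a3 * b3 + a3 * b4 + a4 * b1 + a4 * b2 +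
      a4 * b3 + a2 * b2 + a4 * b4 := by
  have e1 := Nat.mul_le_mul_right b4 h1
  have e2 := Nat.mul_le_mul_left a4 h2
  have e3 : 120 * 120 ≤ (a2 + a3 + a4) * (b2 + b3 + b4) := Nat.mul_le_mul hA hB
  have expand : (a2 + a3 + a4) * (b2 + b3 + b4) =
      a2 * b2 + a2 * b3 + a2 * b4 + a3 * b2 + a3 * b3 + a3 * b4 + a4 * b2 + a4 * b3 + a4 * b4 := by ring
  rw [expand] at e3
  linarith [e1, e2, e3]

/-- **`M ⊕ N` at `(8, 4)`**: both coloop-free of rank `4` on `7` points with all pairs of rank `2`. -/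
theorem c025_eight_four_disjointSum_four_seven_twice (M N : Matroid α) [M.Finite] [N.Finite]
    (h : Disjoint M.E N.E) (hM : M.eRank = ((4 : ℕ) : ℕ∞)) (hME : M.E.ncard = 7) (hcolM : M.coloops = ∅)
    (hpairsM : ∀ e ∈ M.E, ∀ f ∈ M.E, e ≠ f → M.eRk {e, f} = 2) (hN : N.eRank = ((4 : ℕ) : ℕ∞))
    (hNE : N.E.ncard = 7) (hcolN : N.coloops = ∅) (hpairsN : ∀ e ∈ N.E, ∀ f ∈ N.E, e ≠ f → N.eRk {e, f} = 2) :
    phiK 8 4 * ({A : Set α | A ⊆ (M.disjointSum N h).E ∧ (M.disjointSum N h).eRk A = ((8 : ℕ) : ℕ∞) ∧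
        (M.disjointSum N h).eRk ((M.disjointSum N h).E \ A) = ((4 : ℕ) : ℕ∞)}.ncard : ℚ) ≤
      ({A : Set α | A ⊆ (M.disjointSum N h).E ∧ ((4 : ℕ) : ℕ∞) < (M.disjointSum N h).eRk A ∧
        (M.disjointSum N h).eRk A < ((8 : ℕ) : ℕ∞)}.ncard : ℚ) := by
  -- the profiles
  have hM43 := ncard_profileSet_four_three_le_rank_four_seven (N := M) hME
  have hM42 := ncard_profileSet_four_two_le_rank_four_seven (N := M) hME
  have hN43 := ncard_profileSet_four_three_le_rank_four_seven (N := N) hNE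
  have hN42 := ncard_profileSet_four_two_le_rank_four_seven (N := N) hNE
  -- the `U`-side: the slices `(4, 1)`, `(4, 2)`, `(4, 3)`
  have hU : {A : Set α | A ⊆ (M.disjointSum N h).E ∧ (M.disjointSum N h).eRk A = ((8 : ℕ) : ℕ∞) ∧
      (M.disjointSum N h).eRk ((M.disjointSum N h).E \ A) = ((4 : ℕ) : ℕ∞)}.ncard + 7 * (rankTwoTriples N).ncard +
      7 * (rankTwoTriples M).ncard ≤ 490 +
        ({Q : Set α | Q ⊆ M.E ∧ Q.ncard = 5 ∧ M.eRk Q = ((4 : ℕ) : ℕ∞)}.ncard + (rankTwoTriples M).ncard) *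
          ({Q : Set α | Q ⊆ N.E ∧ Q.ncard = 5 ∧ N.eRk Q = ((4 : ℕ) : ℕ∞)}.ncard + (rankTwoTriples N).ncard) := by
    rw [disjointSum_ncard_U_eq_finsum M N h 8 4, finsum_mem_coe_finset]
    have hsub : ({(4, 1), (4, 2), (4, 3)} : Finset (ℕ × ℕ)) ⊆ Finset.range (8 + 1) ×ˢ Finset.range (4 + 1) := by
      decide
    rw [← Finset.sum_subset hsub ?_]
    · rw [Finset.sum_insert (by decide), Finset.sum_insert (by decide), Finset.sum_singleton]
      dsimp only
      show (profileSet M 4 1).ncard * (profileSet N 4 3).ncard + ((profileSet M 4 2).ncard * (profileSet N 4 2).ncard +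
        (profileSet M 4 3).ncard * (profileSet N 4 1).ncard) + 7 * (rankTwoTriples N).ncard +
        7 * (rankTwoTriples M).ncard ≤ _
      have hM41 := ncard_profileSet_top_one_le_of_pairs' hpairsM 4
      rw [hME] at hM41
      have hN41 := ncard_profileSet_top_one_le_of_pairs' hpairsN 4
      rw [hNE] at hN41
      have e1 : (profileSet M 4 1).ncard * (profileSet N 4 3).ncard + 7 * (rankTwoTriples N).ncard ≤ 245 := by
        have := Nat.mul_le_mul hM41 (le_refl (profileSet N 4 3).ncard)
        nlinarith [this, hN43]
      have e2 := Nat.mul_le_mul hM42 hN42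
      have e3 : (profileSet M 4 3).ncard * (profileSet N 4 1).ncard + 7 * (rankTwoTriples M).ncard ≤ 245 := by
        have := Nat.mul_le_mul (le_refl (profileSet M 4 3).ncard) hN41
        nlinarith [this, hM43]
      linarith [e1, e2, e3]
    · rintro ⟨a, b⟩ hmem hnot
      rw [Finset.mem_product, Finset.mem_range, Finset.mem_range] at hmem
      simp only [Finset.mem_insert, Finset.mem_singleton, Prod.mk.injEq, not_or] at hnot
      dsimp only
      rcases Nat.lt_or_ge 4 a with ha | ha
      · rw [profileSet_eq_empty_of_eRank_lt M hM ha b, ncard_empty, zero_mul]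
      rcases Nat.lt_or_ge a 4 with ha' | ha'
      · have h8a : 4 < 8 - a := by omega
        rw [profileSet_eq_empty_of_eRank_lt N hN h8a (4 - b), ncard_empty, mul_zero]
      have ha4 : a = 4 := by omega
      subst ha4
      rw [show (8 : ℕ) - 4 = 4 from rfl]
      rcases Nat.lt_or_ge b 1 with hb | hb
      · have hb0 : b = 0 := by omega
        subst hb0
        rw [profileSet_eq_empty_of_ncard_lt N (by rw [hNE]; norm_num : N.E.ncard < 4 + (4 - 0)), ncard_empty,
          mul_zero]
      · have hb4 : b = 4 := by omega
        subst hb4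
        rw [profileSet_eq_empty_of_ncard_lt M (by rw [hME]; norm_num : M.E.ncard < 4 + 4), ncard_empty, zero_mul]
  -- the `Y`-side: the nine slices
  have hY : 14400 + 7 * (rankSet M 4).ncard + 7 * (rankSet N 4).ncard ≤
      {A : Set α | A ⊆ (M.disjointSum N h).E ∧ ((4 : ℕ) : ℕ∞) < (M.disjointSum N h).eRk A ∧
        (M.disjointSum N h).eRk A < ((8 : ℕ) : ℕ∞)}.ncard + (rankSet M 2).ncard * (rankSet N 2).ncard +
        (rankSet M 4).ncard * (rankSet N 4).ncard := by
    rw [disjointSum_ncard_Y_eq_finsum M N h 8 4, finsum_mem_coe_finset]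
    have hsub : ({(1, 4), (2, 3), (2, 4), (3, 2), (3, 3), (3, 4), (4, 1), (4, 2), (4, 3)} : Finset (ℕ × ℕ)) ⊆
        (Finset.range 8 ×ˢ Finset.range 8).filter (fun x : ℕ × ℕ => 4 < x.1 + x.2 ∧ x.1 + x.2 < 8) := by
      decide
    have hle := Finset.sum_le_sum_of_subset hsub
      (f := fun x : ℕ × ℕ => (rankSet M x.1).ncard * (rankSet N x.2).ncard)
    rw [Finset.sum_insert (by decide), Finset.sum_insert (by decide), Finset.sum_insert (by decide),
      Finset.sum_insert (by decide), Finset.sum_insert (by decide), Finset.sum_insert (by decide),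
      Finset.sum_insert (by decide), Finset.sum_insert (by decide), Finset.sum_singleton] at hle
    dsimp only at hle
    have F1 : 7 ≤ (rankSet M 1).ncard := by
      have := ncard_le_ncard_rankSet_one_of_pairs hpairsM (by omega)
      rwa [hME] at this
    have G1 : 7 ≤ (rankSet N 1).ncard := by
      have := ncard_le_ncard_rankSet_one_of_pairs hpairsN (by omega)
      rwa [hNE] at this
    have hA := ncard_rankSet_two_three_four_ge_of_pairs M hM hpairsM
    rw [hME, show 2 ^ 7 - 1 - 7 = 120 by decide] at hA
    have hB := ncard_rankSet_two_three_four_ge_of_pairs N hN hpairsN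
    rw [hNE, show 2 ^ 7 - 1 - 7 = 120 by decide] at hB
    have hp := y_products_four_seven_twice F1 G1 hA hB
    linarith [hle, hp]
  have hF12 := ncard_rankSet_two_le_rank_four_seven hM hME hcolM
  have hF22 := ncard_rankSet_two_le_rank_four_seven hN hNE hcolN
  have hF14 := ncard_rankSet_four_le_rank_four_seven (N := M) hME
  have hF24 := ncard_rankSet_four_le_rank_four_seven (N := N) hNE
  -- the incidence counts, both parts
  have hM1 := ncard_tripleFourSets_le M hpairsM
  have hM2 := four_mul_ncard_rankTwo_four_le M hpairsM
  have hMeq := ncard_tripleFourSets_eq M hME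
  rw [hMeq] at hM1 hM2
  have hN1 := ncard_tripleFourSets_le N hpairsN
  have hN2 := four_mul_ncard_rankTwo_four_le N hpairsN
  have hNeq := ncard_tripleFourSets_eq N hNE
  rw [hNeq] at hN1 hN2
  have hMbig := ncard_rankTwoTriples_add_rankTwo_four_le_rank_four_seven hM hME hcolM hpairsM
  have hNbig := ncard_rankTwoTriples_add_rankTwo_four_le_rank_four_seven hN hNE hcolN hpairsN
  -- `W + s₄ + q₂ ≤ 35` for both parts
  have hpartM := four_sets_partition_rank_four_seven (N := M) hME
  have hpartN := four_sets_partition_rank_four_seven (N := N) hNE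
  have hs5M : {Q : Set α | Q ⊆ M.E ∧ Q.ncard = 5 ∧ M.eRk Q = ((4 : ℕ) : ℕ∞)}.ncard ≤ 21 := by
    have hf5 : {A : Set α | A ⊆ M.E ∧ A.ncard = 5}.Finite := M.ground_finite.finite_subsets.subset (fun _ hA => hA.1)
    have := ncard_le_ncard (show {Q : Set α | Q ⊆ M.E ∧ Q.ncard = 5 ∧ M.eRk Q = ((4 : ℕ) : ℕ∞)} ⊆
      {A : Set α | A ⊆ M.E ∧ A.ncard = 5} from fun A hA => ⟨hA.1, hA.2.1⟩) hf5
    rwa [ncard_setOf_subset_ncard_eq M.ground_finite 5, hME, show Nat.choose 7 5 = 21 by decide] at this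
  have hs5N : {Q : Set α | Q ⊆ N.E ∧ Q.ncard = 5 ∧ N.eRk Q = ((4 : ℕ) : ℕ∞)}.ncard ≤ 21 := by
    have hf5 : {A : Set α | A ⊆ N.E ∧ A.ncard = 5}.Finite := N.ground_finite.finite_subsets.subset (fun _ hA => hA.1)
    have := ncard_le_ncard (show {Q : Set α | Q ⊆ N.E ∧ Q.ncard = 5 ∧ N.eRk Q = ((4 : ℕ) : ℕ∞)} ⊆
      {A : Set α | A ⊆ N.E ∧ A.ncard = 5} from fun A hA => ⟨hA.1, hA.2.1⟩) hf5
    rwa [ncard_setOf_subset_ncard_eq N.ground_finite 5, hNE, show Nat.choose 7 5 = 21 by decide] at this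
  rw [phiK_eight_four]
  -- name the quantities, then cast once
  have h4M := ncard_rankSet_four_ge_rank_four_seven hM hME hcolM
  have h4N := ncard_rankSet_four_ge_rank_four_seven hN hNE hcolN
  generalize hu0 : {A : Set α | A ⊆ (M.disjointSum N h).E ∧ (M.disjointSum N h).eRk A = ((8 : ℕ) : ℕ∞) ∧
      (M.disjointSum N h).eRk ((M.disjointSum N h).E \ A) = ((4 : ℕ) : ℕ∞)}.ncard = u at hU ⊢
  generalize hy0 : {A : Set α | A ⊆ (M.disjointSum N h).E ∧ ((4 : ℕ) : ℕ∞) < (M.disjointSum N h).eRk A ∧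
      (M.disjointSum N h).eRk A < ((8 : ℕ) : ℕ∞)}.ncard = y at hY ⊢
  generalize ht1 : (rankTwoTriples M).ncard = t1 at *
  generalize ht2 : (rankTwoTriples N).ncard = t2 at *
  generalize hq1 : {Q : Set α | Q ⊆ M.E ∧ Q.ncard = 4 ∧ M.eRk Q = 2}.ncard = q1 at *
  generalize hq2 : {Q : Set α | Q ⊆ N.E ∧ Q.ncard = 4 ∧ N.eRk Q = 2}.ncard = q2 at *
  generalize hw1 : {Q : Set α | Q ⊆ M.E ∧ Q.ncard = 4 ∧ M.eRk Q ≠ 2 ∧ ∃ T ∈ rankTwoTriples M, T ⊆ Q}.ncard = w1 at *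
  generalize hw2 : {Q : Set α | Q ⊆ N.E ∧ Q.ncard = 4 ∧ N.eRk Q ≠ 2 ∧ ∃ T ∈ rankTwoTriples N, T ⊆ Q}.ncard = w2 at *
  generalize hs41 : {Q : Set α | Q ⊆ M.E ∧ Q.ncard = 4 ∧ M.eRk Q = ((4 : ℕ) : ℕ∞)}.ncard = s41 at *
  generalize hs42 : {Q : Set α | Q ⊆ N.E ∧ Q.ncard = 4 ∧ N.eRk Q = ((4 : ℕ) : ℕ∞)}.ncard = s42 at *
  generalize hs51 : {Q : Set α | Q ⊆ M.E ∧ Q.ncard = 5 ∧ M.eRk Q = ((4 : ℕ) : ℕ∞)}.ncard = s51 at *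
  generalize hs52 : {Q : Set α | Q ⊆ N.E ∧ Q.ncard = 5 ∧ N.eRk Q = ((4 : ℕ) : ℕ∞)}.ncard = s52 at *
  generalize hf12 : (rankSet M 2).ncard = f12 at *
  generalize hf22 : (rankSet N 2).ncard = f22 at *
  generalize hf14 : (rankSet M 4).ncard = f14 at *
  generalize hf24 : (rankSet N 4).ncard = f24 at *
  have hYq : (14400 : ℚ) + 112 + 7 * ((s51 : ℚ) + s41 + s52 + s42) ≤ (y : ℚ) + (f12 : ℚ) * f22 + (f14 : ℚ) * f24 := by
    have : 14400 + 112 + 7 * (s51 + s41 + s52 + s42) ≤ y + f12 * f22 + f14 * f24 := by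
      linarith [hY, h4M, h4N]
    exact_mod_cast this
  have hs41' : (s41 : ℚ) + 4 * t1 ≤ 35 + 3 * q1 := by
    have : s41 + 4 * t1 ≤ 35 + 3 * q1 := by omega
    exact_mod_cast this
  have hs42' : (s42 : ℚ) + 4 * t2 ≤ 35 + 3 * q2 := by
    have : s42 + 4 * t2 ≤ 35 + 3 * q2 := by omega
    exact_mod_cast this
  have hU' : (u : ℚ) + 7 * t2 + 7 * t1 ≤ 490 + ((s51 : ℚ) + t1) * ((s52 : ℚ) + t2) := by exact_mod_cast hU
  have hF12' : (f12 : ℚ) ≤ 21 + t1 + q1 := by exact_mod_cast hF12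
  have hF22' : (f22 : ℚ) ≤ 21 + t2 + q2 := by exact_mod_cast hF22
  have hF14' : (f14 : ℚ) ≤ 8 + s51 + s41 := by exact_mod_cast hF14
  have hF24' : (f24 : ℚ) ≤ 8 + s52 + s42 := by exact_mod_cast hF24
  have hM2' : (q1 : ℚ) ≤ t1 := by
    have : q1 ≤ t1 := by omega
    exact_mod_cast this
  have hN2' : (q2 : ℚ) ≤ t2 := by
    have : q2 ≤ t2 := by omega
    exact_mod_cast this
  have hMbig' : (t1 : ℚ) + q1 ≤ 21 := by exact_mod_cast hMbig
  have hNbig' : (t2 : ℚ) + q2 ≤ 21 := by exact_mod_cast hNbig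
  have hs5M' : (s51 : ℚ) ≤ 21 := by exact_mod_cast hs5M
  have hs5N' : (s52 : ℚ) ≤ 21 := by exact_mod_cast hs5N
  have n1 : (0 : ℚ) ≤ t1 := Nat.cast_nonneg t1
  have n2 : (0 : ℚ) ≤ t2 := Nat.cast_nonneg t2
  have n3 : (0 : ℚ) ≤ q1 := Nat.cast_nonneg q1
  have n4 : (0 : ℚ) ≤ q2 := Nat.cast_nonneg q2
  have n5 : (0 : ℚ) ≤ s41 := Nat.cast_nonneg s41
  have n6 : (0 : ℚ) ≤ s42 := Nat.cast_nonneg s42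
  have n7 : (0 : ℚ) ≤ s51 := Nat.cast_nonneg s51
  have n8 : (0 : ℚ) ≤ s52 := Nat.cast_nonneg s52
  have n9 : (0 : ℚ) ≤ f22 := Nat.cast_nonneg f22
  have n10 : (0 : ℚ) ≤ f24 := Nat.cast_nonneg f24
  exact consumer_arith_four_seven_twice (u := (u : ℚ)) (y := (y : ℚ)) (t1 := (t1 : ℚ)) (t2 := (t2 : ℚ))
    (q1 := (q1 : ℚ)) (q2 := (q2 : ℚ)) (s41 := (s41 : ℚ)) (s42 := (s42 : ℚ)) (s51 := (s51 : ℚ)) (s52 := (s52 : ℚ))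
    (F12 := (f12 : ℚ)) (F22 := (f22 : ℚ)) (F14 := (f14 : ℚ)) (F24 := (f24 : ℚ)) hU' hYq hF12' hF22' hF14' hF24'
    hs41' hs42' hM2' hN2' hMbig' hNbig' hs5M' hs5N' n1 n2 n3 n4 n5 n6 n7 n8 n9 n10

end S1

end PercRepro
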